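import Summits.BirchSwinnertonDyer.Rank1Residual.Ordinary.Conjectures.KolyvaginKimDatumOfCanonicalStructure
import Summits.BirchSwinnertonDyer.Rank1Residual.GaloisImage.KolyvaginSystemOfEulerSystemTorsionCoeff
import HarnessLib

/-!
# The Kolyvagin-class datum and LAW-2 from an EULER SYSTEM of `T_pE` at ANY ODD PRIME `p`: C-16's chain composed with the tree's
# generic «Euler system ⇒ Kolyvagin system» THEOREM D (team n1011) — theorems only; nothing asserted; C-16 / the depth law stay CONJECTURES

HONEST FRAMING (cell `b2b-bsdres`, run/shared/lean/b2b/bsd-rank1-residual/, verbatim in every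
file): the goal of the cell is to DELETE the COMBINATION-SHAPED residual classes of the
Birch–Swinnerton-Dyer formula for ALL analytic-rank `≤ 1` elliptic curves over `ℚ` — "full BSD
formula for every rank `≤ 1` curve in class `C`" assembled STRICTLY from published theorems — so
that the rank-`≤ 1` remainder becomes exactly the CONSTRUCTION-SHAPED classes, which are TYPED
(missing-input `Prop`s), NOT attempted. This is not "finishing BSD". Seat `b2b-bsdres-additive-p3`
(X8 prover B / X7 joint; typer-designate for the cell conjecture C-16 = hyp C120.1; ladder BSD:K3 hand-off to cell
`bsd-ssimc`, last generation before the D-0075 sunset). This file books nothing and moves no mark; X7 / X8 stay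
CONSTRUCTION-SHAPED; C-16 and the depth law (`R1-DEPTH-LAW.md`) are CONJECTURES. NO Euler system is asserted to exist (binder `hc`).

## What this file does

`KolyvaginKimDatumOfEulerSystem.lean` (F31) composed F30 with n1011's THEOREM D at `p = 3` (file D6b, coefficients `E[3^{k+1}]_{ℤ_3}`,
rows `E(ℚ₃)[3] = 0`). The LAW-2 consumer of the chain (`zmodPowOrd_kuriharaNumber_eq_of_kolyvaginKimDatum`, F25: the depth law
`ord_p(δ̃_ℓ mod p^k) = min(k, F + 2·v_ℓ(P))` at ANY odd good non-anomalous `p`, any `m_p(P)`, in the derived regime) is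
prime-generic, and so is n1011's THEOREM D file D6 (`GaloisImage/KolyvaginSystemOfEulerSystemTorsionCoeff.lean`,
`Derivative.Rat.exists_isKolyvaginSystem_propagatedSelmerStructure_torsionCoeff`: any odd `p`, coefficients `E[p^{k+1}]_{ℤ_p}`,
the place `p` as the displayed certificate `htop : 𝓕_can,p = ⊤`). This file is the generic-prime composition:

* §1 **`kolyvaginKimDatum_of_isEulerSystem_torsionCoeff_prime`** — `KolyvaginKimDatum W f p ℓ k₀ (k+1) Q vℓ vp ψ` for any odd `p`
  from an Euler system `c` of `T_pE` over `ℚ(μ_{p^{n+1}}, μ_r)` + THEOREM D's binders (incl. `hbad`, `htop`) + F30's binders + ONE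
  reading hypothesis on every derived system (bottom class `κ(Q)`; Kim's reading at `vp`) — proof THEOREM D ∘ `hread` ∘ F30.
* §2 **`zmodPowOrd_kuriharaNumber_eq_of_isEulerSystem_torsionCoeff`** — LAW-2 at `(ℓ, k₀)`: `ord_p(δ̃_ℓ mod p^{k₀}) = min(k₀, F + 2·v_ℓ(P))`
  for any odd good non-anomalous `p` and any formal level `m = m_p(P)`, from Poitou–Tate, the local Euler characteristic at `vℓ`,
  `vp`, the letter data of F25's consumer (`p ∤ Δ_min`, `p ∤ #Ẽ(𝔽_p)`, the formal-filtration datum of `P`, `ℓ` a cyclic Kolyvagin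
  level of depth `k+1 ≥ k₀`, `p ∤ u`, the derived-regime clause), and §1's inputs for `Q = (p^{m+F}·u)·P`. At `p ≥ 5` every
  displayed input is PRINT (Kato's Euler system: Astérisque 295 Thm. 8.1/12.5; Euler ⇒ Kolyvagin: Mazur–Rubin Thm. 3.2.4 — here
  the tree's THEOREM D; bottom class: Thm. 5.2.12; Kim's reading: Kim Thm. 3.13 + (5.3); Poitou–Tate / Euler characteristic:
  Milne I 4.10(b), 2.8) — typed here as binders, NOT as Literature facts (that typing is the K3 typer's T1–T3,
  `HOME/b2b-bsdres-additive-p3/HANDOFF-TO-bsd-ssimc-K3.md` §2); the depth law itself stays a CONJECTURE of the cell.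

References: B. Mazur, K. Rubin, Mem. AMS 799 (2004), Def. 3.2.1, Thm. 3.2.4, Thm. 5.2.12, App. A [MazurRubin2004];
K. Kato, Astérisque 295 (2004), Thm. 8.1, Thm. 12.5 [Kato2004Asterisque]; K. Rubin, *Euler Systems* (2000) Def. 2.1.1,
§4.4 [Rubin2000]; R. Sakamoto, JTNB 36 (2024) §2, Def. 4.1 [Sakamoto2024]; C.-H. Kim, arXiv:2203.12159, Thm. 3.13, (5.3)
[Kim2022StructureSelmer]; J. S. Milne, ADT (2006) I 2.8, 4.10(b) [MilneADT2006].
-/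

noncomputable section

open CategoryTheory Function Finset Field IsDedekindDomain
open scoped NumberField Classical ContRepresentation MatrixGroups
open CongruenceSubgroup WeierstrassCurve Literature.NumberTheory.EllipticCurves
  Literature.NumberTheory.EllipticCurves.ModularForms
  Literature.NumberTheory.EllipticCurves.Rank1Residual
  Literature.NumberTheory.GaloisRepresentations Literature.NumberTheory.GaloisCohomology
  Literature.NumberTheory.GaloisRepresentations.DiscreteGaloisModule
  NumberField
  Summit.BirchSwinnertonDyer.Rank1Residual.GaloisImage
  Summit.BirchSwinnertonDyer.Rank1Residual.GaloisImage.CoeffTransport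
  Summit.BirchSwinnertonDyer.Rank1Residual.GaloisImage.CyclotomicLevel
  Summit.BirchSwinnertonDyer.Rank1Residual.GaloisImage.TorsionCoeff
  Rat.HeightOneSpectrum

namespace Summit.BirchSwinnertonDyer.Rank1Residual.Ordinary

variable (W : WeierstrassCurve ℚ) [W.IsElliptic] [W.IsGloballyMinimal] (p : ℕ) [hp : Fact p.Prime]
variable [Module.Free ℤ_[p] (W.tateModule p)] [Module.Finite ℤ_[p] (W.tateModule p)]
  [ContinuousSMul ℤ_[p] (W.tateModule p)]

/-- Local notation: `T∞ = T_p E` as a continuous `G_ℚ`-representation (as in n1011's THEOREM D files). -/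
local notation3 "T∞" => WeierstrassCurve.tateGaloisRep W p (W.continuous_galoisRepTate_holds p)

variable (S : Set (HeightOneSpectrum (𝓞 ℚ)))

/-- Local notation: `𝓛` = the cyclotomic Euler-system levels `ℚ(μ_{p^{n+1}}, μ_r)`, `r ∩ S = ∅`. -/
local notation3 "𝓛" => cyclotomicLevelsRat p S

/-- Local notation: `𝐃ℤ⟦X, U, τ⟧ ℓ = ∑_{j < ℓ−1} j·(τ_ℓ)_*^j` on `H¹(U, X)` (`ℤ`-linear), Kolyvagin's derivative operator. -/
local notation3 (prettyPrint := false) "𝐃ℤ⟦" X ", " U ", " τ "⟧" =>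
  fun ℓ : HeightOneSpectrum (𝓞 ℚ) =>
  ∑ j ∈ Finset.range (((primesEquiv ℓ : Nat.Primes) : ℕ) - 1),
    (j : Module.End ℤ (continuousCohomology 1 (subgroupRep X U))) *
      (conjMap X U ((τ : HeightOneSpectrum (𝓞 ℚ) → absoluteGaloisGroup ℚ) ℓ) 1).hom.toLinearMap ^ j

/-- Local notation: the level-`j` reduction `red_j : T_pE ⟶ E[p^j]_{ℤ_p}` (n1011 GZ-2). -/
local notation3 "𝐫𝐞𝐝⟦" j "⟧" => tateModuleRed W p (W.continuous_galoisRepTate_holds p) j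

/-! ### §1 The datum from an Euler system of `T_pE`, any odd `p` (generic THEOREM D ∘ F30) -/

section Datum

variable {N : ℕ} (f : CuspForm (Gamma0 N) 2) (ℓ k₀ k : ℕ) [Fact ℓ.Prime] (Q : W.toAffine.Point)
  (vℓ vp : HeightOneSpectrum (𝓞 ℚ)) (ψ : (q : ℕ) → (ZMod q)ˣ →* Multiplicative (ZMod (p ^ k₀)))

/-- **`KolyvaginKimDatum` at depth `k + 1` for ANY ODD PRIME `p` from an EULER SYSTEM of `T_pE` over the cyclotomic levels**
(the generic-prime form of F31 §1, for the LAW-2 consumer at any odd good non-anomalous `p`): binders = the Euler system `c`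
(`hc`; Kato's — NOT asserted), n1011's generic THEOREM D binders (`Derivative.Rat.exists_isKolyvaginSystem_propagatedSelmerStructure_torsionCoeff`:
`Irr(E[p])`, THE CANONICAL Kolyvagin datum `D` on `E[p^k·p]` with cyclotomic transverse conditions and canonical comparison maps,
`𝒫 ⊆` level primes ∩ Kato's Kolyvagin primes of depth `k+1`, the row certificate `hbad` (`E(ℚ_w)[p] = 0` at the bad `w ≠ p`)
and the place-`p` certificate `htop` (`𝓕_can,p = ⊤` on `E[p^k·p]` — at `p = 3` discharged from `E(ℚ₃)[3] = 0` by n1011's F11/F12,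
cf. F31 §1)), F30's binders (Sakamoto's `(Sτ, τ)`, `𝒫` in the `τ`-class, `vℓ ∈ 𝒫` good with `vℓ ∤ p`, `vp ∋ p`, `hdiv`), and ONE
reading hypothesis `hread` on every derived system `(σ, Φ, κ)` satisfying THEOREM D's conclusion verbatim (bottom class `κ(Q)` —
Mazur–Rubin Thm. 5.2.12 — and Kim's reading of `κ_{vℓ}` at `vp` — Kim Thm. 3.13 + (5.3), print for `p ≥ 5`).
[cite: MazurRubin2004, Thm. 3.2.4, Thm. 5.2.12 and App. A] [cite: Kim2022StructureSelmer, Thm. 3.13 and (5.3)]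
[cite: Sakamoto2024, §2 (p. 921) and Def. 4.1 (p. 926)] [cite: Rubin2000, Def. 2.1.1 and Thm. 4.5.4] -/
theorem kolyvaginKimDatum_of_isEulerSystem_torsionCoeff_prime (hp2 : p ≠ 2)
    -- the Euler system and THEOREM D's binders
    {c : ∀ (i : ℕ) (r : (𝓛).Ideals), H1 T∞ ((𝓛).level i r.1)}
    (hc : IsEulerSystem 𝓛 T∞ p c) (hirr : W.HasIrreducibleModPGaloisRep p)
    (D : KolyvaginDatum (W.torsionGaloisModule ((p : ℤ) ^ k * (p : ℤ))))
    (hT : D.transverse = cyclotomicTransverse (W.torsionGaloisModule ((p : ℤ) ^ k * (p : ℤ))))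
    {η : (q : HeightOneSpectrum (𝓞 ℚ)) → (ZMod (Ideal.absNorm q.asIdeal))ˣ}
    (hD : D.HasCanonicalComparison (p ^ (k + 1)) η)
    (hPr : D.primes ⊆ (𝓛).primes)
    (hKol : ∀ q ∈ D.primes, Kato.IsKolyvaginPrime W p (k + 1) ((primesEquiv q : Nat.Primes) : ℕ))
    (hbad : ∀ w : HeightOneSpectrum (𝓞 ℚ), ¬ W.HasGoodReductionAt w →
      ((primesEquiv w : Nat.Primes) : ℕ) ≠ p →
        ∀ P : (W.baseChange (w.adicCompletion ℚ)).toAffine.Point, p • P = 0 → P = 0)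
    (htop : ∀ w : HeightOneSpectrum (𝓞 ℚ), ((primesEquiv w : Nat.Primes) : ℕ) = p →
      propagatedSelmerStructure W p k (Sum.inr w) = ⊤)
    -- F30's binders: Sakamoto's `τ`-class for the canonical datum, the place `vℓ`, the divisibility witness
    (Sτ : Set (HeightOneSpectrum (𝓞 ℚ))) {τ : absoluteGaloisGroup ℚ}
    (hτq : Nonempty (cokerSubOne (W.torsionGaloisModule ((p : ℤ) ^ k * (p : ℤ))) τ ≃+ ZMod (p ^ (k + 1))))
    (hτμ : τ ∈ rootsOfUnityFixer ℚ (p ^ (k + 1)))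
    (hP : D.primes ⊆ frobeniusClassPrimes (W.torsionGaloisModule ((p : ℤ) ^ k * (p : ℤ))) Sτ τ (p ^ (k + 1)))
    (hDℓ : vℓ ∈ D.primes)
    (hdiv : ∀ X : geomPoints W, ∃ R : geomPoints W, ((p : ℤ) ^ k * (p : ℤ)) • R = X)
    (hpv : ((p : ℕ) : 𝓞 ℚ) ∉ vℓ.asIdeal) (hgood : W.HasGoodReductionAt vℓ) (hvp : ((p : ℕ) : 𝓞 ℚ) ∈ vp.asIdeal)
    -- the two READINGS of the derived system: bottom class (MR Thm. 5.2.12) and Kim's reading (Thm. 3.13 + (5.3))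
    (hread : letI := TorsionCoeff.torsionBy.padicIntModule p (k + 1) (WeierstrassCurve.geomPoints W)
      ∀ (σ : HeightOneSpectrum (𝓞 ℚ) → absoluteGaloisGroup ℚ)
        (Φ : ∀ r : Finset (HeightOneSpectrum (𝓞 ℚ)),
          continuousCohomology 1 (subgroupRep (torsionRepPadicInt W p (k + 1)).toTopRep ((𝓛).level ⊥ r)) →+
            continuousCohomology 1 (subgroupRep
              (W.torsionGaloisModule ((p : ℤ) ^ k * (p : ℤ))).toTopRep ((𝓛).level ⊥ r)))
        (comm : ∀ r : Finset (HeightOneSpectrum (𝓞 ℚ)),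
          ((r : Finset _) : Set (HeightOneSpectrum (𝓞 ℚ))).Pairwise fun a b =>
            Commute (𝐃ℤ⟦(W.torsionGaloisModule ((p : ℤ) ^ k * (p : ℤ))).toTopRep, ((𝓛).level ⊥ r), σ⟧ a)
              (𝐃ℤ⟦(W.torsionGaloisModule ((p : ℤ) ^ k * (p : ℤ))).toTopRep, ((𝓛).level ⊥ r), σ⟧ b))
        (κ : Finset (HeightOneSpectrum (𝓞 ℚ)) →
          galoisCohomology (W.torsionGaloisModule ((p : ℤ) ^ k * (p : ℤ))) 1),
        (∀ q, σ q ∈ (adicCompletionPrime ℚ q).inertia (absoluteGaloisGroup ℚ)) →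
        (∀ q, modNCyclotomicCharacter ℚ (Ideal.absNorm q.asIdeal) (σ q) = η q) →
        (∀ r, ∀ (φ : contOneCocycles (subgroupRep (torsionRepPadicInt W p (k + 1)).toTopRep ((𝓛).level ⊥ r)))
          (ψ' : contOneCocycles (subgroupRep
            (W.torsionGaloisModule ((p : ℤ) ^ k * (p : ℤ))).toTopRep ((𝓛).level ⊥ r))),
          (∀ g, ψ'.1 g = AddSubgroup.inclusion (geomTorsion_pow_succ_eq W p k).le (φ.1 g)) →
            Φ r (oneCocycleClass _ φ) = oneCocycleClass _ ψ') →
        D.IsKolyvaginSystem (propagatedSelmerStructure W p k) κ →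
        (∀ r : Finset (HeightOneSpectrum (𝓞 ℚ)), ¬ (↑r : Set _) ⊆ D.primes → κ r = 0) →
        (∀ (r : Finset (HeightOneSpectrum (𝓞 ℚ))) (hr : (↑r : Set _) ⊆ D.primes),
          resSubgroup (W.torsionGaloisModule ((p : ℤ) ^ k * (p : ℤ))).toTopRep ((𝓛).level ⊥ r) 1
              (κ r) =
            (r.noncommProd 𝐃ℤ⟦(W.torsionGaloisModule ((p : ℤ) ^ k * (p : ℤ))).toTopRep,
                ((𝓛).level ⊥ r), σ⟧ (comm r))
              (Φ r (ContinuousCohomology.map (ContinuousMonoidHom.id _)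
                (X := subgroupRep T∞.toTopRep ((𝓛).level ⊥ r))
                (Y := subgroupRep (torsionRepPadicInt W p (k + 1)).toTopRep ((𝓛).level ⊥ r))
                ((TopRep.resFunctor ((𝓛).level ⊥ r).subtype).map 𝐫𝐞𝐝⟦k + 1⟧) 1
                (c ⊥ ⟨r, fun _ hq => hPr (hr (Finset.mem_coe.2 hq))⟩)))) →
        κ ∅ = kummerMapTorsion W ((p : ℤ) ^ k * (p : ℤ)) hdiv Q ∧
        ∀ ψp : galoisCohomology ((W.torsionGaloisModule ((p : ℤ) ^ k * (p : ℤ))).toLocal (Sum.inr vp)) 1 ⧸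
            W.kummerSelmerStructure ((p : ℤ) ^ k * (p : ℤ)) (Sum.inr vp) ≃+ ZMod (p ^ (k + 1)),
          (haveI : NeZero ℓ := ⟨(Fact.out : ℓ.Prime).ne_zero⟩
           zmodPowOrd p k₀ (kuriharaNumber f (p ^ k₀) ℓ ψ)) =
            min k₀ (zmodPowOrd p (k + 1)
              (ψp (galoisCohomology.localization (W.torsionGaloisModule ((p : ℤ) ^ k * (p : ℤ)))
                (Sum.inr vp) 1 (κ {vℓ}))))) :
    KolyvaginKimDatum W f p ℓ k₀ (k + 1) Q vℓ vp ψ := by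
  letI := TorsionCoeff.torsionBy.padicIntModule p (k + 1) (WeierstrassCurve.geomPoints W)
  obtain ⟨σ, Φ, comm, κ, hσI, hσχ, hΦ, hKS, hκ0, hκc⟩ :=
    Derivative.Rat.exists_isKolyvaginSystem_propagatedSelmerStructure_torsionCoeff W p S hp2 hc k hirr D hT hD hPr
      hKol hbad htop
  obtain ⟨h1, hkim⟩ := hread σ Φ comm κ hσI hσχ hΦ hKS hκ0 hκc
  exact kolyvaginKimDatum_of_isKolyvaginSystem_canonicalStructure W f p ℓ k₀ k Q vℓ vp ψ hp2 Sτ hτq hτμ hP hD hDℓ hdiv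
    hpv hgood hvp hKS h1 hkim

end Datum

/-! ### §2 LAW-2 at `(ℓ, k₀)` for any odd good non-anomalous `p` from an Euler system of `T_pE` -/

section Law

variable {N : ℕ} (f : CuspForm (Gamma0 N) 2) (ℓ k₀ k : ℕ) [Fact ℓ.Prime] (P : W.toAffine.Point) (F m : ℕ)
  (vℓ vp : HeightOneSpectrum (𝓞 ℚ)) (ψ : (q : ℕ) → (ZMod q)ˣ →* Multiplicative (ZMod (p ^ k₀)))

/-- **LAW-2 at `(ℓ, k₀)` from an EULER SYSTEM of `T_pE`** (any odd `p`, good and non-anomalous for `E`, any formal level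
`m = m_p(P)`, derived regime): `ord_p(δ̃_ℓ mod p^{k₀}) = min(k₀, F + 2·v_ℓ(P))` from Poitou–Tate over `ℚ`, the local Euler
characteristic at `vℓ` and `vp`, the letter data of F25's consumer `zmodPowOrd_kuriharaNumber_eq_of_kolyvaginKimDatum` (`p ∤ Δ_min`,
`p ∤ #Ẽ(𝔽_p)`, the formal-filtration datum `hm1`/`hm2` of `P`, `ℓ` a cyclic Kolyvagin level with `ℓ ∈ 𝒫_{k+1}`, `k₀ ≤ k+1`,
`p ∤ u`, the regime clause `hreg`), and §1's inputs for `Q = (p^{m+F}·u)·P`: an Euler system `c` of `T_pE` over the cyclotomic levels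
(Kato's — a binder, NOT asserted), THEOREM D's binders (`Irr(E[p])`, THE CANONICAL datum `D ∋ vℓ` on `E[p^k·p]`, `hbad`, `htop`),
Sakamoto's `(Sτ, τ)`, the divisibility witness, and the reading hypothesis on every derived system (bottom class `κ((p^{m+F}·u)·P)`,
Kim's reading of `κ_{vℓ}` at `vp`). At `p ≥ 5` every displayed input is print (Kato; Mazur–Rubin Thm. 3.2.4 = the tree's THEOREM D,
Thm. 5.2.12; Kim Thm. 3.13; Milne I 4.10(b), 2.8); the law stays a CONJECTURE of the cell (nothing here asserts its inputs).
[cite: MazurRubin2004, Thm. 3.2.4, Thm. 5.2.12 and App. A] [cite: Kim2022StructureSelmer, Thm. 3.13 and (5.3)]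
[cite: MilneADT2006, Ch. I, Thm. 4.10(b) and Thm. 2.8] [cite: Sakamoto2024, §2 (p. 921) and Def. 4.1 (p. 926)] -/
theorem zmodPowOrd_kuriharaNumber_eq_of_isEulerSystem_torsionCoeff (hp2 : p ≠ 2)
    (hgoodp : ¬ (p : ℤ) ∣ minimalDiscriminantInt W) (hna : ¬ p ∣ W.reductionPointCount p)
    (hm1 : W.reductionPointCount p • Affine.Point.map (W' := W.toAffine) (Algebra.ofId ℚ ℚ_[p]) P ∈
      (W.baseChange ℚ_[p]).formalFiltration (m + 1))
    (hm2 : W.reductionPointCount p • Affine.Point.map (W' := W.toAffine) (Algebra.ofId ℚ ℚ_[p]) P ∉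
      (W.baseChange ℚ_[p]).formalFiltration (m + 2))
    (hcycℓ : IsCyclicKolyvaginLevel W p ℓ)
    (hvℓ : (ℓ : 𝓞 ℚ) ∈ vℓ.asIdeal) (hvp : ((p : ℕ) : 𝓞 ℚ) ∈ vp.asIdeal)
    (hPT : poitouTate_sum_localTatePairing_eq_zero ℚ)
    (hEPℓ : localEulerPoincareCharacteristic (vℓ.adicCompletion ℚ))
    (hEPp : localEulerPoincareCharacteristic (vp.adicCompletion ℚ))
    (hk : k₀ ≤ k + 1) (hKP : Kato.IsKolyvaginPrime W p (k + 1) ℓ) {u : ℕ} (hu : ¬ p ∣ u)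
    (hreg : m = 0 ∨ m + F + 2 * localDivExponent W p ℓ P < k + 1)
    -- the Euler system and THEOREM D's binders
    {c : ∀ (i : ℕ) (r : (𝓛).Ideals), H1 T∞ ((𝓛).level i r.1)}
    (hc : IsEulerSystem 𝓛 T∞ p c) (hirr : W.HasIrreducibleModPGaloisRep p)
    (D : KolyvaginDatum (W.torsionGaloisModule ((p : ℤ) ^ k * (p : ℤ))))
    (hT : D.transverse = cyclotomicTransverse (W.torsionGaloisModule ((p : ℤ) ^ k * (p : ℤ))))
    {η : (q : HeightOneSpectrum (𝓞 ℚ)) → (ZMod (Ideal.absNorm q.asIdeal))ˣ}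
    (hD : D.HasCanonicalComparison (p ^ (k + 1)) η)
    (hPr : D.primes ⊆ (𝓛).primes)
    (hKol : ∀ q ∈ D.primes, Kato.IsKolyvaginPrime W p (k + 1) ((primesEquiv q : Nat.Primes) : ℕ))
    (hbad : ∀ w : HeightOneSpectrum (𝓞 ℚ), ¬ W.HasGoodReductionAt w →
      ((primesEquiv w : Nat.Primes) : ℕ) ≠ p →
        ∀ P : (W.baseChange (w.adicCompletion ℚ)).toAffine.Point, p • P = 0 → P = 0)
    (htop : ∀ w : HeightOneSpectrum (𝓞 ℚ), ((primesEquiv w : Nat.Primes) : ℕ) = p →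
      propagatedSelmerStructure W p k (Sum.inr w) = ⊤)
    -- Sakamoto's `τ`-class for the canonical datum, `vℓ ∈ 𝒫`, the divisibility witness
    (Sτ : Set (HeightOneSpectrum (𝓞 ℚ))) {τ : absoluteGaloisGroup ℚ}
    (hτq : Nonempty (cokerSubOne (W.torsionGaloisModule ((p : ℤ) ^ k * (p : ℤ))) τ ≃+ ZMod (p ^ (k + 1))))
    (hτμ : τ ∈ rootsOfUnityFixer ℚ (p ^ (k + 1)))
    (hP : D.primes ⊆ frobeniusClassPrimes (W.torsionGaloisModule ((p : ℤ) ^ k * (p : ℤ))) Sτ τ (p ^ (k + 1)))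
    (hDℓ : vℓ ∈ D.primes)
    (hdiv : ∀ X : geomPoints W, ∃ R : geomPoints W, ((p : ℤ) ^ k * (p : ℤ)) • R = X)
    -- the two READINGS of the derived system, for `Q = (p^{m+F}·u)·P`
    (hread : letI := TorsionCoeff.torsionBy.padicIntModule p (k + 1) (WeierstrassCurve.geomPoints W)
      ∀ (σ : HeightOneSpectrum (𝓞 ℚ) → absoluteGaloisGroup ℚ)
        (Φ : ∀ r : Finset (HeightOneSpectrum (𝓞 ℚ)),
          continuousCohomology 1 (subgroupRep (torsionRepPadicInt W p (k + 1)).toTopRep ((𝓛).level ⊥ r)) →+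
            continuousCohomology 1 (subgroupRep
              (W.torsionGaloisModule ((p : ℤ) ^ k * (p : ℤ))).toTopRep ((𝓛).level ⊥ r)))
        (comm : ∀ r : Finset (HeightOneSpectrum (𝓞 ℚ)),
          ((r : Finset _) : Set (HeightOneSpectrum (𝓞 ℚ))).Pairwise fun a b =>
            Commute (𝐃ℤ⟦(W.torsionGaloisModule ((p : ℤ) ^ k * (p : ℤ))).toTopRep, ((𝓛).level ⊥ r), σ⟧ a)
              (𝐃ℤ⟦(W.torsionGaloisModule ((p : ℤ) ^ k * (p : ℤ))).toTopRep, ((𝓛).level ⊥ r), σ⟧ b))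
        (κ : Finset (HeightOneSpectrum (𝓞 ℚ)) →
          galoisCohomology (W.torsionGaloisModule ((p : ℤ) ^ k * (p : ℤ))) 1),
        (∀ q, σ q ∈ (adicCompletionPrime ℚ q).inertia (absoluteGaloisGroup ℚ)) →
        (∀ q, modNCyclotomicCharacter ℚ (Ideal.absNorm q.asIdeal) (σ q) = η q) →
        (∀ r, ∀ (φ : contOneCocycles (subgroupRep (torsionRepPadicInt W p (k + 1)).toTopRep ((𝓛).level ⊥ r)))
          (ψ' : contOneCocycles (subgroupRep
            (W.torsionGaloisModule ((p : ℤ) ^ k * (p : ℤ))).toTopRep ((𝓛).level ⊥ r))),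
          (∀ g, ψ'.1 g = AddSubgroup.inclusion (geomTorsion_pow_succ_eq W p k).le (φ.1 g)) →
            Φ r (oneCocycleClass _ φ) = oneCocycleClass _ ψ') →
        D.IsKolyvaginSystem (propagatedSelmerStructure W p k) κ →
        (∀ r : Finset (HeightOneSpectrum (𝓞 ℚ)), ¬ (↑r : Set _) ⊆ D.primes → κ r = 0) →
        (∀ (r : Finset (HeightOneSpectrum (𝓞 ℚ))) (hr : (↑r : Set _) ⊆ D.primes),
          resSubgroup (W.torsionGaloisModule ((p : ℤ) ^ k * (p : ℤ))).toTopRep ((𝓛).level ⊥ r) 1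
              (κ r) =
            (r.noncommProd 𝐃ℤ⟦(W.torsionGaloisModule ((p : ℤ) ^ k * (p : ℤ))).toTopRep,
                ((𝓛).level ⊥ r), σ⟧ (comm r))
              (Φ r (ContinuousCohomology.map (ContinuousMonoidHom.id _)
                (X := subgroupRep T∞.toTopRep ((𝓛).level ⊥ r))
                (Y := subgroupRep (torsionRepPadicInt W p (k + 1)).toTopRep ((𝓛).level ⊥ r))
                ((TopRep.resFunctor ((𝓛).level ⊥ r).subtype).map 𝐫𝐞𝐝⟦k + 1⟧) 1
                (c ⊥ ⟨r, fun _ hq => hPr (hr (Finset.mem_coe.2 hq))⟩)))) →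
        κ ∅ = kummerMapTorsion W ((p : ℤ) ^ k * (p : ℤ)) hdiv ((p ^ (m + F) * u) • P) ∧
        ∀ ψp : galoisCohomology ((W.torsionGaloisModule ((p : ℤ) ^ k * (p : ℤ))).toLocal (Sum.inr vp)) 1 ⧸
            W.kummerSelmerStructure ((p : ℤ) ^ k * (p : ℤ)) (Sum.inr vp) ≃+ ZMod (p ^ (k + 1)),
          (haveI : NeZero ℓ := ⟨(Fact.out : ℓ.Prime).ne_zero⟩
           zmodPowOrd p k₀ (kuriharaNumber f (p ^ k₀) ℓ ψ)) =
            min k₀ (zmodPowOrd p (k + 1)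
              (ψp (galoisCohomology.localization (W.torsionGaloisModule ((p : ℤ) ^ k * (p : ℤ)))
                (Sum.inr vp) 1 (κ {vℓ}))))) :
    (haveI : NeZero ℓ := ⟨(Fact.out : ℓ.Prime).ne_zero⟩
     zmodPowOrd p k₀ (kuriharaNumber f (p ^ k₀) ℓ ψ)) = min k₀ (F + 2 * localDivExponent W p ℓ P) := by
  obtain ⟨hpv, hgood⟩ := IsKolyvaginPrime.not_mem_and_hasGoodReductionAt W hKP hvℓ
  exact zmodPowOrd_kuriharaNumber_eq_of_kolyvaginKimDatum W f p ℓ k₀ P F m hp2 hgoodp hna hm1 hm2 hcycℓ hvℓ hvp hPT hEPℓ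
    hEPp ψ hk hKP hu
    (kolyvaginKimDatum_of_isEulerSystem_torsionCoeff_prime W p S f ℓ k₀ k _ vℓ vp ψ hp2 hc hirr D hT hD hPr hKol hbad htop
      Sτ hτq hτμ hP hDℓ hdiv hpv hgood hvp hread)
    hreg

end Law

end Summit.BirchSwinnertonDyer.Rank1Residual.Ordinary

end
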